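import Summits.QuantumFields.YangMills.Theorems.VirialFluxGapAssemblyOfCentralFieldSharp
import Summits.QuantumFields.YangMills.Theorems.VirialFluxGapCentralFieldFamilySharp
import Summits.QuantumFields.YangMills.Theorems.VirialFluxGapGibbsMeanWindowOfSmoothFrameFieldFamily
import Summits.QuantumFields.YangMills.Theorems.VirialFluxGapRingFrameDerivativeBounds
import Summits.QuantumFields.YangMills.Theorems.VirialFluxGapGradientEnergyBoundL4
import HarnessLib

/-!
# Route `SwapVirialDeficit` ∕ `VirialFluxGap` (YangMills): ⟨stmt-QuantumFields-24196⟩ `SwapVirialDeficit.ToronSoftnessSharp` BY NAME — the (P) road closed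
# (PART V♯: the δ-family of patched Euler fields on `X_fix`; δ-rerun S6, LEAD sfw-p2 g97 allocation ➊)

For every `δ > 0` the δ-sharp assembly ✓`assembly_at_L_sharp` (Part IV♯) — fed by LEAD g97's SHARP CENTRAL FIELD FAMILY ✓`centralFieldFamily_sharp`
(at target `d/4`, `d = min δ (1/100)`), the drive-loss scale `E = 4/d` (`400 ≤ E`, `d⁻¹ ≤ E`, `E⁻¹ = d/4`), the three absolute constants
(✓`exists_bound_frameD3_ringPoly`, ✓`exists_frameD_sq_le_L4_ringDeficit`, ✓`RegCutoff.exists_bound_deriv_deficitStep`) and the scale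
`A = 2K_C² + E + 80/d + 1032960·10⁴ + (C₃+1)² + 21⁵ + (Dψ+1) + (2C₂+2)`, `a = 2q_C + 20`, `K = 2A²⁰`, `q = 20a` — produces, for all `L ≥ L₀(δ)`, smooth
frame coefficients `c` and `ε` with `0 ≤ ε ≤ 1/4`, `ε·L⁴ ≤ d ≤ δ`, `0 ≤ Σ c·g` everywhere, `2(1−ε)F_fix ≤ Σ c·g` on `{F_fix < (K·L^q)⁻¹}` and
`Σ ∂c ≤ 18L⁴ − 3 + d ≤ 18L⁴ − 3 + δ`: exactly the hypothesis of LEAD's last-mile socket (E3) ✓`FixField.toronSoftnessSharp_of_smoothFrameFieldFamily_cutoff`,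
which concludes ⟨24196⟩ BY NAME (via ✓`gibbsMeanWindow_of_smoothFrameFieldFamily_cutoff` and ✓`SectorMixture.toronSoftnessSharp_of_gibbsMeanWindow`).

* ★★★ `toronSoftnessSharp_proof : Summit.QuantumFields.YangMills.Theses.SwapVirialDeficit.ToronSoftnessSharp`.

HONEST LABEL: this closes the statement item ⟨24196⟩ `ToronSoftnessSharp` (a (P)-road node of route `SwapVirialDeficit`) from tree theorems — fcl-p3 g41's
⟨24141⟩ assembly (Parts I–V), w2∕w3∕LEAD g97's central field, kernel vectors and sockets, and this seat's δ-rerun S1–S5; it is NOT ⟨24194⟩ `SwapMeanActionGap`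
(which needs in addition the sharp per-sector Laplace laws (S), OPEN) nor ⟨24197⟩ (OPEN); item of record ⟨24085⟩ SubOctaveBounded aside ∕ untouched; the
Yang–Mills mass gap is NOT proved; no summit is proved by a line.  THEOREMS ONLY (0 `def`, 0 `sorry`), standard axioms.  Seat ym-line-fcl-p3 g47 (cell
ym-idea-1, free hands), `--workitem stmt-QuantumFields-24196`.  References: [cite: Griffiths1964]; [cite: Luscher1983, §2]; [cite: tHooft1979]; [folklore].
-/


set_option autoImplicit false

noncomputable section

open scoped Matrix BigOperators ContDiff Topology Quaternion
open MeasureTheory Set Matrix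
open Literature.MathematicalPhysics.QuantumFieldTheory hiding SU2
open Literature.MathematicalPhysics.QuantumLattice
open Literature.MathematicalPhysics.QuantumFieldTheory.SUNBakryEmery (expSU coe_expSU matTop)

namespace Summit.QuantumFields.YangMills.Theorems.VirialFluxGap.FrameHessian

open Summit.QuantumFields.YangMills.Theorems.FemtoTransferGap
open Summit.QuantumFields.YangMills.Theorems.FemtoTransferGap.TT
open Summit.QuantumFields.YangMills.Theorems.FemtoTransferGap.TwoLattice
open Summit.QuantumFields.YangMills.Theorems.FemtoTransferGap.TwoLattice.Flat
open Summit.QuantumFields.YangMills.Theorems.VirialFluxGap.RingDeficit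
open Summit.QuantumFields.YangMills.Theorems.VirialFluxGap.FrameDerivative
open Summit.QuantumFields.YangMills.Theorems.VirialFluxGap.ResolventField
open Summit.QuantumFields.YangMills.Theorems.VirialFluxGap.RegularValley
open Summit.QuantumFields.YangMills.Theorems.VirialFluxGap.FixFrame
open Summit.QuantumFields.YangMills.Theorems.VirialFluxGap.RegCutoff
open Summit.QuantumFields.YangMills.Theorems.VirialFluxGap.FixField
open Summit.QuantumFields.YangMills.Theorems.VirialFluxGap.PatchingBudget

variable {L : ℕ} [NeZero L]

open scoped Matrix.Norms.Frobenius

/-! ## ⟨24196⟩ by name -/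

/-- ★★★ **⟨24196⟩ `SwapVirialDeficit.ToronSoftnessSharp` HOLDS**: for every `δ > 0` and all large `L`, the Gibbs mean of the σ-glued `t = 0`
deficit action of the `(2L−1) × L³` ring is within `(3 − δ)/2 + o(1)` of `9L⁴` — by the δ-family of patched Euler fields on `X_fix`
(✓`assembly_at_L_sharp` with LEAD's ✓`centralFieldFamily_sharp`) plugged into LEAD's socket ✓`toronSoftnessSharp_of_smoothFrameFieldFamily_cutoff`.
[cite: Griffiths1964] [cite: Luscher1983, §2] -/
theorem toronSoftnessSharp_proof : Summit.QuantumFields.YangMills.Theses.SwapVirialDeficit.ToronSoftnessSharp := by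
  classical
  refine toronSoftnessSharp_of_smoothFrameFieldFamily_cutoff fun δ hδ => ?_
  -- WLOG `δ ≤ 1/100`: work at `d = min δ (1/100)`
  set d : ℝ := min δ (1 / 100) with hddef
  have hd0 : 0 < d := lt_min hδ (by norm_num)
  have hd1' : d ≤ 1 / 100 := min_le_right _ _
  have hd1 : d ≤ 1 := hd1'.trans (by norm_num)
  have hdδ : d ≤ δ := min_le_left _ _
  -- the drive-loss scale `E = 4/d`
  have hE : (400 : ℝ) ≤ 4 / d := by
    rw [le_div_iff₀ hd0]; linarith only [hd1']
  have hE0 : (0 : ℝ) < 4 / d := by positivity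
  have hEδ : d⁻¹ ≤ 4 / d := by
    rw [inv_eq_one_div]; exact div_le_div_of_nonneg_right (by norm_num) hd0.le
  -- the sharp central family at target `d/4`
  obtain ⟨K_C, hK_C, q_C, L₀, hpack⟩ := centralFieldFamily_sharp (d / 4) (by positivity)
  obtain ⟨C₃, hC₃0, hC₃⟩ := exists_bound_frameD3_ringPoly
  obtain ⟨C₂, hC₂0, hC₂⟩ := exists_frameD_sq_le_L4_ringDeficit
  obtain ⟨Dψ, hDψ0, hDψ⟩ := _root_.Summit.QuantumFields.YangMills.Theorems.VirialFluxGap.RegCutoff.exists_bound_deriv_deficitStep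
  obtain ⟨A, hA1, hAE, hAδ, hA3, hA4, hA5, hA7, hA8⟩ : ∃ A : ℝ, 2 * K_C ^ 2 ≤ A ∧ 4 / d ≤ A ∧ 80 / d ≤ A ∧ 1032960 * 10000 ≤ A ∧ (C₃ + 1) ^ 2 ≤ A ∧
      (21 : ℝ) ^ 5 ≤ A ∧ Dψ + 1 ≤ A ∧ 2 * C₂ + 2 ≤ A := by
    have hsq1 : 0 ≤ 2 * K_C ^ 2 := by positivity
    have hsq2 : 0 ≤ (C₃ + 1) ^ 2 := by positivity
    have h5 : (0 : ℝ) ≤ (21 : ℝ) ^ 5 := by positivity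
    have h80 : (0 : ℝ) ≤ 80 / d := by positivity
    refine ⟨2 * K_C ^ 2 + 4 / d + 80 / d + 1032960 * 10000 + (C₃ + 1) ^ 2 + 21 ^ 5 + (Dψ + 1) + (2 * C₂ + 2), ?_, ?_, ?_, ?_, ?_, ?_, ?_, ?_⟩ <;>
      linarith only [hsq1, hsq2, h5, h80, hE0, hDψ0, hC₂0]
  obtain ⟨a, ha1, ha2⟩ : ∃ a : ℕ, 2 * q_C ≤ a ∧ 20 ≤ a := ⟨2 * q_C + 20, by omega, by omega⟩
  refine ⟨2 * A ^ 20, ?_, ((20 * a : ℕ) : ℝ), ?_, L₀, fun L _ hL => ?_⟩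
  · have hA2 : (400 : ℝ) ≤ A := hE.trans hAE
    have hA1' : (1 : ℝ) ≤ A := by linarith only [hA2]
    have h1 : A ≤ A ^ 20 := le_self_pow₀ hA1' (by norm_num)
    linarith only [h1, hA2]
  · have : (400 : ℕ) ≤ 20 * a := by omega
    have h' : ((400 : ℕ) : ℝ) ≤ ((20 * a : ℕ) : ℝ) := by exact_mod_cast this
    push_cast at h' ⊢
    linarith only [h']
  · obtain ⟨ρ, t_C, N, ε_C, C, hρlo, hρhi, htC, hN0, hN, -, hεC, hCs, hP⟩ := hpack L hL
    have hεC' : ε_C * (L : ℝ) ^ 4 ≤ (4 / d)⁻¹ := by rw [inv_div]; exact hεC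
    obtain ⟨c, ε, hcs, hε0, hε4, hεL, hpos, hdrive, hdiv⟩ :=
      assembly_at_L_sharp (L := L) hC₃0 (hC₃ L) hC₂0 (hC₂ L) hDψ0 hDψ hK_C hd0 hd1 hE hEδ hAE hAδ hA1 hA3 hA4 hA5 hA7 hA8 ha1 ha2
        hρlo hρhi htC hN0 hN hεC' hCs hP
    exact ⟨c, ε, hcs, hε0, hε4, hεL.trans hdδ, hpos, hdrive, fun x => (hdiv x).trans (by linarith only [hdδ])⟩

/-! ## The δ-family by name (LEAD g97's request 17:09Z: the hypothesis `h` of ✓`gibbsMeanWindow_of_smoothFrameFieldFamily_cutoff` as a theorem) -/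

/-- ★★★ **THE δ-FAMILY OF SMOOTH FRAME FIELDS ON `X_fix`, BY NAME** — literally the hypothesis `h` of LEAD's sockets
✓`FixField.gibbsMeanWindow_of_smoothFrameFieldFamily_cutoff` ∕ ✓`toronSoftnessSharp_of_smoothFrameFieldFamily_cutoff` ∕
✓`swapMeanActionGap_of_smoothFrameFieldFamily_cutoff_of_sharpSectorLaplace`: for every `δ > 0` there are `K ≥ 240`, `q ≥ 4`, `L₀` and, for every
`L ≥ L₀`, smooth frame coefficients `c` and `ε ∈ [0, 1/4]` with `ε·L⁴ ≤ δ`, `0 ≤ Σ c·g` everywhere, `2(1−ε)F_fix ≤ Σ c·g` on `{F_fix < (K·L^q)⁻¹}` and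
`Σ ∂c ≤ 18L⁴ − 3 + δ` (same construction as `toronSoftnessSharp_proof`: ✓`assembly_at_L_sharp` + ✓`centralFieldFamily_sharp (d/4)`, `d = min δ (1/100)`,
`E = 4/d`). [cite: Griffiths1964] [cite: Luscher1983, §2] -/
theorem smoothFrameFieldFamily_sharp :
    ∀ δ : ℝ, 0 < δ → ∃ K : ℝ, 240 ≤ K ∧ ∃ q : ℝ, 4 ≤ q ∧ ∃ L₀ : ℕ, ∀ (L : ℕ) [NeZero L], L₀ ≤ L →
      ∃ (c : FixVar L × Fin 3 → ((Fin (2 * L - 1 + 1) → Edge 3 L → Matrix (Fin 2) (Fin 2) ℂ) × (Site 3 L → Matrix (Fin 2) (Fin 2) ℂ)) → ℝ) (ε : ℝ),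
        (∀ va, ContDiff ℝ ∞ (c va)) ∧ 0 ≤ ε ∧ ε ≤ 1 / 4 ∧ ε * (L : ℝ) ^ 4 ≤ δ ∧
        (∀ x : (OffIdx L → SU2) × ((Fin (2 * L - 1) → GaugeConfig 3 L SU2) × (Site 3 L → SU2)), 0 ≤ ∑ va, c va (ringCoord L ((Fin.cons (glue x.1) x.2.1 : Fin (2 * L - 1 + 1) → GaugeConfig 3 L SU2), x.2.2)) * frameGrad (L := L) fixFrameStd (ringCoord L ((Fin.cons (glue x.1) x.2.1 : Fin (2 * L - 1 + 1) → GaugeConfig 3 L SU2), x.2.2)) va) ∧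
        (∀ x : (OffIdx L → SU2) × ((Fin (2 * L - 1) → GaugeConfig 3 L SU2) × (Site 3 L → SU2)), ringDeficit L (fun _ => false) ((Fin.cons (glue x.1) x.2.1 : Fin (2 * L - 1 + 1) → GaugeConfig 3 L SU2), x.2.2) < (K * (L : ℝ) ^ q)⁻¹ →
          2 * (1 - ε) * ringDeficit L (fun _ => false) ((Fin.cons (glue x.1) x.2.1 : Fin (2 * L - 1 + 1) → GaugeConfig 3 L SU2), x.2.2) ≤
            ∑ va, c va (ringCoord L ((Fin.cons (glue x.1) x.2.1 : Fin (2 * L - 1 + 1) → GaugeConfig 3 L SU2), x.2.2)) * frameGrad (L := L) fixFrameStd (ringCoord L ((Fin.cons (glue x.1) x.2.1 : Fin (2 * L - 1 + 1) → GaugeConfig 3 L SU2), x.2.2)) va) ∧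
        (∀ x : (OffIdx L → SU2) × ((Fin (2 * L - 1) → GaugeConfig 3 L SU2) × (Site 3 L → SU2)), ∑ va, frameD (fixFrameStd va) (c va) (ringCoord L ((Fin.cons (glue x.1) x.2.1 : Fin (2 * L - 1 + 1) → GaugeConfig 3 L SU2), x.2.2)) ≤ 18 * (L : ℝ) ^ 4 - 3 + δ) := by
  classical
  intro δ hδ
  -- WLOG `δ ≤ 1/100`: work at `d = min δ (1/100)`
  set d : ℝ := min δ (1 / 100) with hddef
  have hd0 : 0 < d := lt_min hδ (by norm_num)
  have hd1' : d ≤ 1 / 100 := min_le_right _ _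
  have hd1 : d ≤ 1 := hd1'.trans (by norm_num)
  have hdδ : d ≤ δ := min_le_left _ _
  -- the drive-loss scale `E = 4/d`
  have hE : (400 : ℝ) ≤ 4 / d := by
    rw [le_div_iff₀ hd0]; linarith only [hd1']
  have hE0 : (0 : ℝ) < 4 / d := by positivity
  have hEδ : d⁻¹ ≤ 4 / d := by
    rw [inv_eq_one_div]; exact div_le_div_of_nonneg_right (by norm_num) hd0.le
  -- the sharp central family at target `d/4`
  obtain ⟨K_C, hK_C, q_C, L₀, hpack⟩ := centralFieldFamily_sharp (d / 4) (by positivity)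
  obtain ⟨C₃, hC₃0, hC₃⟩ := exists_bound_frameD3_ringPoly
  obtain ⟨C₂, hC₂0, hC₂⟩ := exists_frameD_sq_le_L4_ringDeficit
  obtain ⟨Dψ, hDψ0, hDψ⟩ := _root_.Summit.QuantumFields.YangMills.Theorems.VirialFluxGap.RegCutoff.exists_bound_deriv_deficitStep
  obtain ⟨A, hA1, hAE, hAδ, hA3, hA4, hA5, hA7, hA8⟩ : ∃ A : ℝ, 2 * K_C ^ 2 ≤ A ∧ 4 / d ≤ A ∧ 80 / d ≤ A ∧ 1032960 * 10000 ≤ A ∧ (C₃ + 1) ^ 2 ≤ A ∧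
      (21 : ℝ) ^ 5 ≤ A ∧ Dψ + 1 ≤ A ∧ 2 * C₂ + 2 ≤ A := by
    have hsq1 : 0 ≤ 2 * K_C ^ 2 := by positivity
    have hsq2 : 0 ≤ (C₃ + 1) ^ 2 := by positivity
    have h5 : (0 : ℝ) ≤ (21 : ℝ) ^ 5 := by positivity
    have h80 : (0 : ℝ) ≤ 80 / d := by positivity
    refine ⟨2 * K_C ^ 2 + 4 / d + 80 / d + 1032960 * 10000 + (C₃ + 1) ^ 2 + 21 ^ 5 + (Dψ + 1) + (2 * C₂ + 2), ?_, ?_, ?_, ?_, ?_, ?_, ?_, ?_⟩ <;>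
      linarith only [hsq1, hsq2, h5, h80, hE0, hDψ0, hC₂0]
  obtain ⟨a, ha1, ha2⟩ : ∃ a : ℕ, 2 * q_C ≤ a ∧ 20 ≤ a := ⟨2 * q_C + 20, by omega, by omega⟩
  refine ⟨2 * A ^ 20, ?_, ((20 * a : ℕ) : ℝ), ?_, L₀, fun L _ hL => ?_⟩
  · have hA2 : (400 : ℝ) ≤ A := hE.trans hAE
    have hA1' : (1 : ℝ) ≤ A := by linarith only [hA2]
    have h1 : A ≤ A ^ 20 := le_self_pow₀ hA1' (by norm_num)
    linarith only [h1, hA2]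
  · have : (400 : ℕ) ≤ 20 * a := by omega
    have h' : ((400 : ℕ) : ℝ) ≤ ((20 * a : ℕ) : ℝ) := by exact_mod_cast this
    push_cast at h' ⊢
    linarith only [h']
  · obtain ⟨ρ, t_C, N, ε_C, C, hρlo, hρhi, htC, hN0, hN, -, hεC, hCs, hP⟩ := hpack L hL
    have hεC' : ε_C * (L : ℝ) ^ 4 ≤ (4 / d)⁻¹ := by rw [inv_div]; exact hεC
    obtain ⟨c, ε, hcs, hε0, hε4, hεL, hpos, hdrive, hdiv⟩ :=
      assembly_at_L_sharp (L := L) hC₃0 (hC₃ L) hC₂0 (hC₂ L) hDψ0 hDψ hK_C hd0 hd1 hE hEδ hAE hAδ hA1 hA3 hA4 hA5 hA7 hA8 ha1 ha2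
        hρlo hρhi htC hN0 hN hεC' hCs hP
    exact ⟨c, ε, hcs, hε0, hε4, hεL.trans hdδ, hpos, hdrive, fun x => (hdiv x).trans (by linarith only [hdδ])⟩

/-- ★★ **(P) — the `∀δ′` deep-window bound on the Gibbs mean of the `t = 0` ring deficit, `β⟨F⟩_β ≤ 9L⁴ − 3/2 + δ′` for `L ≤ β^a` — as a theorem**: LEAD's socket ✓`gibbsMeanWindow_of_smoothFrameFieldFamily_cutoff` at the
δ-family ✓`smoothFrameFieldFamily_sharp`. [cite: Griffiths1964] [cite: Luscher1983, §2] -/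
theorem gibbsMeanWindow_sharp :
    ∀ δ' : ℝ, 0 < δ' → ∃ a : ℝ, 0 < a ∧ ∃ β₀ : ℝ, ∃ L₀ : ℕ, ∀ β : ℝ, β₀ ≤ β → ∀ (L : ℕ) [NeZero L], L₀ ≤ L → (L : ℝ) ≤ β ^ a →
      β * (∫ p, ringDeficit L (fun _ => false) p * Real.exp (-(β * ringDeficit L (fun _ => false) p)) ∂(ringMeasure L)) /
          (∫ p, Real.exp (-(β * ringDeficit L (fun _ => false) p)) ∂(ringMeasure L)) ≤ 9 * (L : ℝ) ^ 4 - 3 / 2 + δ' :=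
  gibbsMeanWindow_of_smoothFrameFieldFamily_cutoff smoothFrameFieldFamily_sharp

end Summit.QuantumFields.YangMills.Theorems.VirialFluxGap.FrameHessian

end
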